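import Summits.BirchSwinnertonDyer.Rank1Residual.Additive.X4RankOneKimPartialLattice
import Summits.BirchSwinnertonDyer.Rank1Residual.Additive.X4RankOneKimCorner
import HarnessLib

/-!
# Kim 2025 Thm. 1.1 ("BSD") in analytic rank ONE at LEVEL `𝒩_k` (mod `p^k`): the per-pair shapes
# DERIVED from the ONE primary `Kim2025.thm11_kimShaLength_of_integralPeriod_OPEN` (P1)
# (cell `b2b-bsdres`, team n1011, seat p11, OWNERS row **T-a4-LK**; lead GEN 4 R5-3; additive-p3 / X8 ask)

HONEST FRAMING (cell `b2b-bsdres`, run/shared/lean/b2b/bsd-rank1-residual/, verbatim in every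
file): the goal of the cell is to DELETE the COMBINATION-SHAPED residual classes of the
Birch–Swinnerton-Dyer formula for ALL analytic-rank `≤ 1` elliptic curves over `ℚ` — "full BSD
formula for every rank `≤ 1` curve in class `C`" assembled STRICTLY from published theorems — so
that the rank-`≤ 1` remainder becomes exactly the CONSTRUCTION-SHAPED classes, which are TYPED
(missing-input `Prop`s), NOT attempted. This is not "finishing BSD". Team n1011 is a RESEARCH ROUTE;
no claim beyond the stated classes; no label or mark is changed by this file; nothing is booked. An
ANNOUNCED preprint enters ONLY as an explicitly labelled OPEN hypothesis: every theorem below carrying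
`hK25s : Kim2025.thm11_kimShaLength_of_integralPeriod_OPEN` is CONDITIONAL on the unrefereed
arXiv:2505.09121v1 (FLAG `Kim2025-preprint`, referee-1 ACK-1 T-a4 proviso 3). THEOREMS ONLY: no
definition, no `@[conjecture]`, no named fact — ONE-PRIMARY rule (lead R3-18 (c)): P1 stays the only
primary for Thm. 1.1; everything here is a formal consequence of P1 and the tree's `∂`-API.

## What this file does (the `r = 1` twin of p09's rank-zero level-`k` member `cor17_levelK_le_of_thm11`)

Kim 2025 Thm. 1.1 ("BSD") second clause in analytic rank one (`L(E,1) = 0 ⇒ δ̃_1 = [0]⁺_f = 0`; one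
non-zero prime-level Kurihara number makes `ord(δ̃) = 1`): `length Ш(E/ℚ)[p^∞] = ∂^{(1)}(δ̃) − ∂^{(∞)}(δ̃)`.
A Kurihara number NON-ZERO MODULO `p^k` at a prime `ℓ ∈ 𝒫_k(E,p)` with `#Ẽ(𝔽_ℓ)[p] ≤ p` gives
`∂^{(1)} ≤ k − 1` (`kuriharaPartial_one_le_of_kuriharaNumber_ne_zero`, p17), hence the **LEVEL-`k` SHAPE**
`ord_p #Ш(E/ℚ)(p) + ∂^{(∞)} ≤ k − 1` — `k = 1` the unit clause (p09 (D3), p17's `KimRankOneUnitAt`),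
`k = 2` the level-two clause (p17's `KimRankOneLevelTwoAt`; the `p ≥ 5` published fact).

* §1 OWN CURRENCY (P1's: newform `f` of `W`, `Ω⁺_f` an integral period — `0 ≤ ord_p [r]⁺_f` whenever
  `[r]⁺_f ≠ 0` —, `p ≥ 3`, tower `ρ̄_{E,p^n}` onto ∀ `n`, `Ш(E/ℚ)` finite, `L(E,1) = 0`), from P1:
  `rankOne_shaLength_eq_of_thm11` (the rank-one `∂`-clause itself: `ord_p #Ш(p) + ∂^{(∞)} = ∂^{(1)}` in
  `ℕ∞` once `∂^{(1)} ≠ ∞` — the `hLe` input of p17's binder-free cores, `X4RankOneKimCorner.lean` §0),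
  `rankOne_sha_val_add_partialInfty_le_of_thm11_of_levelK` (`∃ d, ∂^{(∞)} = d ∧ ord_p #Ш(p) + d ≤ k − 1`),
  `rankOne_sha_val_le_of_thm11_of_levelK` (`ord_p #Ш(p) ≤ k − 1`); with the `≥` half of Kim's
  Conjecture 1.10 (p12's `X4.KimTamagawaDefectGeAt W p f`, CONSUMED as an explicit hypothesis):
  `rankOne_sha_val_add_tamagawa_le_of_thm11_of_levelK` (`ord_p #Ш(p) + ord_p ∏c ≤ k − 1`) and at the
  exact level `k = ord_p ∏c + 1`: `rankOne_card_primaryComponent_eq_one_of_thm11_of_exactLevel`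
  (`#Ш(E/ℚ)(p) = 1`) — the rank-one TAM-row shape the X8/O3/O7 consumers asked for, now resting on
  P1 (+ Conj. 1.10's `≥` half) instead of a separate conjecture.
* §2 DATUM CURRENCY (p17's binders `D`, `p ∤ c_D`, period transfer): `rankOne_sha_val_[add_partialInfty_]le_of_partial_of_levelK`
  — the Tamagawa-free level-`k` shape from p17's `∂`-clause `KimRankOnePartialAt W p` ALONE (p17 landed
  `k = 1, 2` and the Tamagawa compositions).
* §3 ONE-PRIMARY BOOKKEEPING: P1 ⟹ p17's `@[conjecture]` predicates, modulo the flagged integrality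
  binder for every datum's newform (FLAG `Kim2025-OmegaE-integrality`, `LargeImageStructureOPEN`
  APPEND docstring; dischargeable per ROUTE-1 F-d v2 = OWNERS T-R18b): `kimRankOnePartialAt_of_thm11_of_integral`,
  `kimRankOneUnitAt_of_thm11_of_integral`, `kimRankOneLevelTwoAt_of_thm11_of_integral`,
  `rankOne_sha_val_le_of_thm11_of_integral_of_levelK` (datum currency, level `k`), the TAM compositions
  `rankOne_sha_val_add_tamagawa_le_of_thm11_of_integral_of_levelK` / `rankOne_card_primaryComponent_eq_one_of_thm11_of_integral_of_exactLevel`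
  (via p17's `…_of_partial_of_tamagawaDefectGe`), and at `p = 3` `kimThreeRankOnePartial_of_thm11_of_integral` / `x4SharpThree…`
  — so p17's five rank-one `@[conjecture]` predicates follow from P1 ∧ integrality (no independent input).

NOT claimed: existence of any certificate (Kim 2025 Thm. 1.2 (rk1+ε) needs `p² ∤ N`; the certificate is
census input); no class theorem; `W.analyticRank = 1` is carried only where p17's predicates carry it
(§1 needs `L(E,1) = 0` and the certificate: P1's clause reads `ord(δ̃) = 1`).

References: Kim 2025 [Kim2025RefinedTNC] Thm. 1.1, §1.4.4 (PREPRINT); Kim 2026 [Kim2022StructureSelmer]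
Thm. 1.9 (6), §1.4.3–1.5.1, Conj. 1.10, Def. 2.13; Sakamoto 2024 [Sakamoto2024KolyvaginThree] Thm. 1.1.
-/

noncomputable section

open scoped Classical MatrixGroups ModularForm

open CongruenceSubgroup WeierstrassCurve Literature.NumberTheory.EllipticCurves
  Literature.NumberTheory.EllipticCurves.ModularForms
  Literature.NumberTheory.EllipticCurves.Rank1Residual
  Literature.NumberTheory.EllipticCurves.Rank1Residual.Typed

namespace Summit.BirchSwinnertonDyer.Rank1Residual.Additive

variable (W : WeierstrassCurve ℚ) [W.IsElliptic] [W.IsGloballyMinimal] (p : ℕ) [hp : Fact p.Prime]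

/-! ### §1 Own currency: P1 ⟹ the rank-one `∂`-clause and the level-`k` shapes -/

/-- **(LK-0) P1 ⟹ the rank-one `∂`-clause in OWN currency: `ord_p #Ш(E/ℚ)(p) + ∂^{(∞)}(δ̃) = ∂^{(1)}(δ̃)`**
(in `ℕ∞`).  `p ≥ 3`, tower, `L(E,1) = 0`, `Ш(E/ℚ)` finite, newform `f` of `W` with `Ω⁺_f` an integral
period, and `∂^{(1)}(δ̃) ≠ ∞` (some cyclic prime-level Kurihara number is non-zero) ⟹ the equality:
`δ̃_1 = [0]⁺_f = 0` (`L(E,1) = 0`) and `∂^{(1)} ≠ ∞` give `ord(δ̃) = 1` (`kuriharaVanishingOrder_eq_one`),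
and P1 at `r = 1` returns `d = ∂^{(∞)} ∈ ℕ` with `∂^{(1)} = ord_p #Ш(p) + d`.  This is the own-currency
twin of p17's `KimRankOnePartialAt` conclusion; its `≤` content is the `hLe` input of p17's binder-free
cores (`X4RankOneKimCorner.lean` §0). CONDITIONAL on the preprint (flag `Kim2025-preprint`).
[claim: Kim2025RefinedTNC, status: under-review] [cite: Kim2025RefinedTNC, Thm. 1.1 ("BSD") (ANNOUNCED, OPEN binder)]
[cite: Kim2022StructureSelmer, Thm. 1.9 (6), §1.4.3–1.4.4, §1.5.1 (PDF pp. 7–8)] -/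
theorem rankOne_shaLength_eq_of_thm11
    (hK25s : Kim2025.thm11_kimShaLength_of_integralPeriod_OPEN)
    (hp3 : 3 ≤ p) (htower : ∀ n : ℕ, W.HasSurjectiveModNGaloisRep (p ^ n : ℕ))
    (hL : W.entireLFunction 1 = 0) (hfin : Finite W.sha)
    {N : ℕ} [NeZero N] {f : CuspForm (Gamma0 N) 2} (hf : IsNewformOf W f)
    (hint : ∀ r : ℚ, ratPlusSymbol f r ≠ 0 → 0 ≤ padicValRat p (ratPlusSymbol f r))
    (hne : kuriharaPartial W p f 1 ≠ ⊤) :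
    (padicValNat p (Nat.card (AddCommGroup.primaryComponent W.sha p)) : ℕ∞) +
        kuriharaPartialInfty W p f = kuriharaPartial W p f 1 := by
  have hord : kuriharaVanishingOrder W p f = 1 :=
    kuriharaVanishingOrder_eq_one W p f
      (kuriharaDivIndex_one_eq_top_of_entireLFunction_one_eq_zero W p f hf hL) hne
  obtain ⟨d, hd, hr⟩ := hK25s W p hp3 htower hfin f hf hint 1 hord
  rw [hd, hr]
  push_cast
  rfl

/-- **(LK-1) P1 ⟹ `ord_p #Ш(E/ℚ)(p) + ∂^{(∞)}(δ̃) ≤ k − 1` in analytic rank one from ONE level-`k`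
certificate**: `p ≥ 3`, tower, `L(E,1) = 0`, `Ш(E/ℚ)` finite, newform `f` with `Ω⁺_f` integral, `k ≥ 1`,
a Kolyvagin PRIME `ℓ ∈ 𝒫_k(E,p)` with `#Ẽ(𝔽_ℓ)[p] ≤ p`, `ψ_ℓ : (ℤ/ℓ)ˣ ↠ ℤ/p^k`, `kuriharaNumber f (p^k) ℓ ψ ≠ 0`
⟹ `∂^{(∞)} = d ∈ ℕ` and `ord_p #Ш(p) + d ≤ k − 1` (certificate ⇒ `∂^{(1)} ≤ k − 1`; then (LK-0)). CONDITIONAL on the preprint.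
[claim: Kim2025RefinedTNC, status: under-review] [cite: Kim2025RefinedTNC, Thm. 1.1 ("BSD") (ANNOUNCED, OPEN binder)]
[cite: Kim2022StructureSelmer, Thm. 1.9 (6), §1.4.4, §1.5.1 (PDF pp. 7–8), Def. 2.13 (PDF p. 14)] -/
theorem rankOne_sha_val_add_partialInfty_le_of_thm11_of_levelK
    (hK25s : Kim2025.thm11_kimShaLength_of_integralPeriod_OPEN)
    (hp3 : 3 ≤ p) (htower : ∀ n : ℕ, W.HasSurjectiveModNGaloisRep (p ^ n : ℕ))
    (hL : W.entireLFunction 1 = 0) (hfin : Finite W.sha)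
    {N : ℕ} [NeZero N] {f : CuspForm (Gamma0 N) 2} (hf : IsNewformOf W f)
    (hint : ∀ r : ℚ, ratPlusSymbol f r ≠ 0 → 0 ≤ padicValRat p (ratPlusSymbol f r))
    {k : ℕ} (hk : 1 ≤ k) (ℓ : ℕ) [Fact ℓ.Prime] (hℓ : Kato.IsKolyvaginPrime W p k ℓ)
    (hcyc : Nat.card {P : ((WeierstrassCurve.integralModelInt W).map
        (Int.castRingHom (ZMod ℓ))).toAffine.Point // p • P = 0} ≤ p)
    (ψ : (ℓ' : ℕ) → (ZMod ℓ')ˣ →* Multiplicative (ZMod (p ^ k)))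
    (hψ : Function.Surjective (ψ ℓ)) (hδ : kuriharaNumber f (p ^ k) ℓ ψ ≠ 0) :
    ∃ d : ℕ, kuriharaPartialInfty W p f = d ∧
      padicValNat p (Nat.card (AddCommGroup.primaryComponent W.sha p)) + d ≤ k - 1 := by
  have h1 : kuriharaPartial W p f 1 ≤ ((k - 1 : ℕ) : ℕ∞) :=
    kuriharaPartial_one_le_of_kuriharaNumber_ne_zero W p f hk hℓ hcyc ψ hψ hδ
  have hne : kuriharaPartial W p f 1 ≠ ⊤ := ne_top_of_le_ne_top (ENat.coe_ne_top _) h1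
  have heq := rankOne_shaLength_eq_of_thm11 W p hK25s hp3 htower hL hfin hf hint hne
  -- `∂^{(∞)} ≤ ∂^{(1)} < ∞` is a natural number
  have hdtop : kuriharaPartialInfty W p f ≠ ⊤ :=
    ne_top_of_le_ne_top hne (kuriharaPartialInfty_le W p f 1)
  obtain ⟨d, hd⟩ := ENat.ne_top_iff_exists.mp hdtop
  refine ⟨d, hd.symm, ?_⟩
  have h2 : (padicValNat p (Nat.card (AddCommGroup.primaryComponent W.sha p)) : ℕ∞) + (d : ℕ∞) ≤
      ((k - 1 : ℕ) : ℕ∞) := by rw [hd, heq]; exact h1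
  exact_mod_cast h2

/-- **(LK-2) P1 ⟹ `ord_p #Ш(E/ℚ)(p) ≤ k − 1` in analytic rank one from ONE Kurihara number non-zero
modulo `p^k` at a cyclic Kolyvagin prime of level `k`** — the LEVEL-`k` SHAPE (`k = 1`: p09's
`rankOne_sha_val_eq_zero_of_thm11`; `k = 2`: the level-two clause). [claim: Kim2025RefinedTNC, status: under-review]
[cite: Kim2025RefinedTNC, Thm. 1.1 ("BSD") (ANNOUNCED, OPEN binder)] [cite: Kim2022StructureSelmer, Thm. 1.9 (6), §1.5.1 (PDF pp. 7–8)] -/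
theorem rankOne_sha_val_le_of_thm11_of_levelK
    (hK25s : Kim2025.thm11_kimShaLength_of_integralPeriod_OPEN)
    (hp3 : 3 ≤ p) (htower : ∀ n : ℕ, W.HasSurjectiveModNGaloisRep (p ^ n : ℕ))
    (hL : W.entireLFunction 1 = 0) (hfin : Finite W.sha)
    {N : ℕ} [NeZero N] {f : CuspForm (Gamma0 N) 2} (hf : IsNewformOf W f)
    (hint : ∀ r : ℚ, ratPlusSymbol f r ≠ 0 → 0 ≤ padicValRat p (ratPlusSymbol f r))
    {k : ℕ} (hk : 1 ≤ k) (ℓ : ℕ) [Fact ℓ.Prime] (hℓ : Kato.IsKolyvaginPrime W p k ℓ)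
    (hcyc : Nat.card {P : ((WeierstrassCurve.integralModelInt W).map
        (Int.castRingHom (ZMod ℓ))).toAffine.Point // p • P = 0} ≤ p)
    (ψ : (ℓ' : ℕ) → (ZMod ℓ')ˣ →* Multiplicative (ZMod (p ^ k)))
    (hψ : Function.Surjective (ψ ℓ)) (hδ : kuriharaNumber f (p ^ k) ℓ ψ ≠ 0) :
    padicValNat p (Nat.card (AddCommGroup.primaryComponent W.sha p)) ≤ k - 1 := by
  obtain ⟨d, -, h⟩ := rankOne_sha_val_add_partialInfty_le_of_thm11_of_levelK W p hK25s hp3 htower hL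
    hfin hf hint hk ℓ hℓ hcyc ψ hψ hδ
  omega

/-- **(LK-3) P1 ∧ the `≥` half of Kim's Conjecture 1.10 ⟹ `ord_p #Ш(E/ℚ)(p) + ord_p ∏_ℓ c_ℓ ≤ k − 1`**
in analytic rank one from ONE level-`k` prime certificate (own currency): p17's binder-free core
`padicValNat_primaryComponent_add_le_of_shaLengthLe_of_tamagawaDefectGe` (`X4RankOneKimCorner.lean`
§0, CONSUMED by name) with its `hLe` input supplied by (LK-0); `X4.KimTamagawaDefectGeAt W p f` =
`ord_p ∏c ≤ ∂^{(∞)}(δ̃)` is p12's T-N10C predicate, an explicit hypothesis — so on a row with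
`ord_p ∏c ≥ 1` a certificate exists only at levels `k ≥ ord_p ∏c + 1`. CONDITIONAL on the preprint and
on Conj. 1.10. [claim: Kim2025RefinedTNC, status: under-review]
[cite: Kim2025RefinedTNC, Thm. 1.1 ("BSD") (ANNOUNCED, OPEN binder)] [cite: Kim2022StructureSelmer, Thm. 1.9 (6), Conj. 1.10 (PDF p. 8)] -/
theorem rankOne_sha_val_add_tamagawa_le_of_thm11_of_levelK
    (hK25s : Kim2025.thm11_kimShaLength_of_integralPeriod_OPEN)
    (hp3 : 3 ≤ p) (htower : ∀ n : ℕ, W.HasSurjectiveModNGaloisRep (p ^ n : ℕ))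
    (hL : W.entireLFunction 1 = 0) (hfin : Finite W.sha)
    {N : ℕ} [NeZero N] {f : CuspForm (Gamma0 N) 2} (hf : IsNewformOf W f)
    (hint : ∀ r : ℚ, ratPlusSymbol f r ≠ 0 → 0 ≤ padicValRat p (ratPlusSymbol f r))
    (hGe : X4.KimTamagawaDefectGeAt W p f)
    {k : ℕ} (hk : 1 ≤ k) (ℓ : ℕ) [Fact ℓ.Prime] (hℓ : Kato.IsKolyvaginPrime W p k ℓ)
    (hcyc : Nat.card {P : ((WeierstrassCurve.integralModelInt W).map
        (Int.castRingHom (ZMod ℓ))).toAffine.Point // p • P = 0} ≤ p)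
    (ψ : (ℓ' : ℕ) → (ZMod ℓ')ˣ →* Multiplicative (ZMod (p ^ k)))
    (hψ : Function.Surjective (ψ ℓ)) (hδ : kuriharaNumber f (p ^ k) ℓ ψ ≠ 0) :
    padicValNat p (Nat.card (AddCommGroup.primaryComponent W.sha p)) +
      padicValNat p W.tamagawaProduct ≤ k - 1 := by
  have hne : kuriharaPartial W p f 1 ≠ ⊤ := ne_top_of_le_ne_top (ENat.coe_ne_top _)
    (kuriharaPartial_one_le_of_kuriharaNumber_ne_zero W p f hk hℓ hcyc ψ hψ hδ)
  exact padicValNat_primaryComponent_add_le_of_shaLengthLe_of_tamagawaDefectGe W p f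
    (le_of_eq (rankOne_shaLength_eq_of_thm11 W p hK25s hp3 htower hL hfin hf hint hne)) hGe hk ℓ hℓ
    hcyc ψ hψ hδ

/-- **(LK-4) The EXACT level closes the pair**: P1 ∧ Conj. 1.10's `≥` half ∧ ONE Kurihara number
non-zero modulo `p^{ord_p ∏c + 1}` at a cyclic Kolyvagin prime of level `ord_p ∏c + 1` (so of `p`-adic
valuation exactly `ord_p ∏c`, as Conjecture 1.10 predicts) ⟹ `#Ш(E/ℚ)(p) = 1` in analytic rank one.
Both conjectural inputs explicit. [claim: Kim2025RefinedTNC, status: under-review] [cite: Kim2025RefinedTNC, Thm. 1.1 ("BSD") (ANNOUNCED, OPEN binder)]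
[cite: Kim2022StructureSelmer, Thm. 1.9 (6), Conj. 1.10 (PDF p. 8)] -/
theorem rankOne_card_primaryComponent_eq_one_of_thm11_of_exactLevel
    (hK25s : Kim2025.thm11_kimShaLength_of_integralPeriod_OPEN)
    (hp3 : 3 ≤ p) (htower : ∀ n : ℕ, W.HasSurjectiveModNGaloisRep (p ^ n : ℕ))
    (hL : W.entireLFunction 1 = 0) (hfin : Finite W.sha)
    {N : ℕ} [NeZero N] {f : CuspForm (Gamma0 N) 2} (hf : IsNewformOf W f)
    (hint : ∀ r : ℚ, ratPlusSymbol f r ≠ 0 → 0 ≤ padicValRat p (ratPlusSymbol f r))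
    (hGe : X4.KimTamagawaDefectGeAt W p f)
    (ℓ : ℕ) [Fact ℓ.Prime] (hℓ : Kato.IsKolyvaginPrime W p (padicValNat p W.tamagawaProduct + 1) ℓ)
    (hcyc : Nat.card {P : ((WeierstrassCurve.integralModelInt W).map
        (Int.castRingHom (ZMod ℓ))).toAffine.Point // p • P = 0} ≤ p)
    (ψ : (ℓ' : ℕ) → (ZMod ℓ')ˣ →* Multiplicative (ZMod (p ^ (padicValNat p W.tamagawaProduct + 1))))
    (hψ : Function.Surjective (ψ ℓ))
    (hδ : kuriharaNumber f (p ^ (padicValNat p W.tamagawaProduct + 1)) ℓ ψ ≠ 0) :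
    Nat.card (AddCommGroup.primaryComponent W.sha p) = 1 := by
  haveI : Finite W.sha := hfin
  have h := rankOne_sha_val_add_tamagawa_le_of_thm11_of_levelK W p hK25s hp3 htower hL hfin hf hint
    hGe (by omega) ℓ hℓ hcyc ψ hψ hδ
  exact card_primaryComponent_eq_one_of_padicValNat_eq_zero W p (by omega)

/-! ### §2 Datum currency: the level-`k` shape from p17's `∂`-clause `KimRankOnePartialAt` alone -/

/-- **`KimRankOnePartialAt W p` ⟹ the level-`k` shape WITH its `∂^{(∞)}` term** (datum currency, p17's
binder convention): under the rank-one binders, a Kurihara number non-zero modulo `p^k` at a cyclic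
`ℓ ∈ 𝒫_k` gives `ord_p #Ш(E/ℚ)(p) + ∂^{(∞)}(δ̃) ≤ k − 1` in `ℕ∞` (`∂^{(1)} ≤ k − 1`). General-`k`
form of p17's `kimRankOneLevelTwoAt_of_partial`; Tamagawa-free. [cite: Kim2022StructureSelmer, Thm. 1.9 (6), §1.5.1 (PDF pp. 7–8)] -/
theorem rankOne_sha_val_add_partialInfty_le_of_partial_of_levelK (hK : KimRankOnePartialAt W p)
    (hsurj : W.HasSurjectiveModNGaloisRep p)
    (htower : ∀ n : ℕ, W.HasSurjectiveModNGaloisRep (p ^ n : ℕ)) (hL : W.entireLFunction 1 = 0)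
    (hr : W.analyticRank = 1) (hfin : Finite W.sha)
    {N : ℕ} [NeZero N] (D : ModularParametrizationData W N) (hc : ¬ (p : ℤ) ∣ D.maninConstant)
    (hper : ∃ u : ℚ, ‖(u : ℚ_[p])‖ = 1 ∧ W.realPeriodRat = u * plusPeriod D.f)
    {k : ℕ} (hk : 1 ≤ k) (ℓ : ℕ) [Fact ℓ.Prime] (hℓ : Kato.IsKolyvaginPrime W p k ℓ)
    (hcyc : Nat.card {P : ((WeierstrassCurve.integralModelInt W).map
        (Int.castRingHom (ZMod ℓ))).toAffine.Point // p • P = 0} ≤ p)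
    (ψ : (ℓ' : ℕ) → (ZMod ℓ')ˣ →* Multiplicative (ZMod (p ^ k)))
    (hψ : Function.Surjective (ψ ℓ)) (hδ : kuriharaNumber D.f (p ^ k) ℓ ψ ≠ 0) :
    (padicValNat p (Nat.card (AddCommGroup.primaryComponent W.sha p)) : ℕ∞) +
        kuriharaPartialInfty W p D.f ≤ ((k - 1 : ℕ) : ℕ∞) := by
  have h1 : kuriharaPartial W p D.f 1 ≤ ((k - 1 : ℕ) : ℕ∞) :=
    kuriharaPartial_one_le_of_kuriharaNumber_ne_zero W p D.f hk hℓ hcyc ψ hψ hδ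
  have hne : kuriharaPartial W p D.f 1 ≠ ⊤ := ne_top_of_le_ne_top (ENat.coe_ne_top _) h1
  have hmain := hK hsurj htower hL hr hfin D hc hper hne
  exact (le_of_eq hmain).trans h1

/-- **`KimRankOnePartialAt W p` ⟹ `ord_p #Ш(E/ℚ)(p) ≤ k − 1` from ONE level-`k` prime certificate**
(datum currency): the general-`k` reading of p17's `KimRankOneUnitAt` (`k = 1`) and
`KimRankOneLevelTwoAt` (`k = 2`). [cite: Kim2022StructureSelmer, Thm. 1.9 (6), §1.5.1 (PDF pp. 7–8)] -/
theorem rankOne_sha_val_le_of_partial_of_levelK (hK : KimRankOnePartialAt W p)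
    (hsurj : W.HasSurjectiveModNGaloisRep p)
    (htower : ∀ n : ℕ, W.HasSurjectiveModNGaloisRep (p ^ n : ℕ)) (hL : W.entireLFunction 1 = 0)
    (hr : W.analyticRank = 1) (hfin : Finite W.sha)
    {N : ℕ} [NeZero N] (D : ModularParametrizationData W N) (hc : ¬ (p : ℤ) ∣ D.maninConstant)
    (hper : ∃ u : ℚ, ‖(u : ℚ_[p])‖ = 1 ∧ W.realPeriodRat = u * plusPeriod D.f)
    {k : ℕ} (hk : 1 ≤ k) (ℓ : ℕ) [Fact ℓ.Prime] (hℓ : Kato.IsKolyvaginPrime W p k ℓ)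
    (hcyc : Nat.card {P : ((WeierstrassCurve.integralModelInt W).map
        (Int.castRingHom (ZMod ℓ))).toAffine.Point // p • P = 0} ≤ p)
    (ψ : (ℓ' : ℕ) → (ZMod ℓ')ˣ →* Multiplicative (ZMod (p ^ k)))
    (hψ : Function.Surjective (ψ ℓ)) (hδ : kuriharaNumber D.f (p ^ k) ℓ ψ ≠ 0) :
    padicValNat p (Nat.card (AddCommGroup.primaryComponent W.sha p)) ≤ k - 1 := by
  have h := rankOne_sha_val_add_partialInfty_le_of_partial_of_levelK W p hK hsurj htower hL hr hfin D
    hc hper hk ℓ hℓ hcyc ψ hψ hδ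
  have h' : (padicValNat p (Nat.card (AddCommGroup.primaryComponent W.sha p)) : ℕ∞) ≤
      ((k - 1 : ℕ) : ℕ∞) := le_trans le_self_add h
  exact_mod_cast h'

/-! ### §3 One-primary bookkeeping: P1 ⟹ p17's rank-one predicates, modulo the integrality binder -/

/-- **P1 ⟹ `KimRankOnePartialAt W p`** modulo the flagged integrality binder (`Ω⁺_{D.f}` is an integral
period for every datum `D`; FLAG `Kim2025-OmegaE-integrality`): under the rank-one binders of the
predicate, (LK-0) `rankOne_shaLength_eq_of_thm11` for the datum's newform `D.f` IS the conclusion.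
So p17's `@[conjecture]` `∂`-clause is NOT an independent input at `p ≥ 3`.
CONDITIONAL on the preprint (flag `Kim2025-preprint`). [claim: Kim2025RefinedTNC, status: under-review]
[cite: Kim2025RefinedTNC, Thm. 1.1 ("BSD") (ANNOUNCED, OPEN binder)] [cite: Kim2022StructureSelmer, Thm. 1.9 (6), §1.4.3–1.4.4 (PDF pp. 7–8)] -/
theorem kimRankOnePartialAt_of_thm11_of_integral
    (hK25s : Kim2025.thm11_kimShaLength_of_integralPeriod_OPEN) (hp3 : 3 ≤ p)
    (hint : ∀ {N : ℕ} [NeZero N] (D : ModularParametrizationData W N) (r : ℚ),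
      ratPlusSymbol D.f r ≠ 0 → 0 ≤ padicValRat p (ratPlusSymbol D.f r)) :
    KimRankOnePartialAt W p :=
  fun _ htower hL _ hfin _ _ D _ _ hne =>
    rankOne_shaLength_eq_of_thm11 W p hK25s hp3 htower hL hfin D.isNewformOf (hint D) hne

/-- **P1 ⟹ `KimRankOneUnitAt W p`** modulo the integrality binder (via p17's `kimRankOneUnitAt_of_partial`).
CONDITIONAL on the preprint. [claim: Kim2025RefinedTNC, status: under-review]
[cite: Kim2025RefinedTNC, Thm. 1.1 ("BSD") (ANNOUNCED, OPEN binder)] [cite: Kim2022StructureSelmer, Thm. 1.9 (1), (4), (6) (PDF pp. 7–8)] -/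
theorem kimRankOneUnitAt_of_thm11_of_integral
    (hK25s : Kim2025.thm11_kimShaLength_of_integralPeriod_OPEN) (hp3 : 3 ≤ p)
    (hint : ∀ {N : ℕ} [NeZero N] (D : ModularParametrizationData W N) (r : ℚ),
      ratPlusSymbol D.f r ≠ 0 → 0 ≤ padicValRat p (ratPlusSymbol D.f r)) :
    KimRankOneUnitAt W p :=
  kimRankOneUnitAt_of_partial W p (kimRankOnePartialAt_of_thm11_of_integral W p hK25s hp3 hint)

/-- **P1 ⟹ `KimRankOneLevelTwoAt W p`** modulo the integrality binder (via p17's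
`kimRankOneLevelTwoAt_of_partial`). CONDITIONAL on the preprint. [claim: Kim2025RefinedTNC, status: under-review]
[cite: Kim2025RefinedTNC, Thm. 1.1 ("BSD") (ANNOUNCED, OPEN binder)] [cite: Kim2022StructureSelmer, Thm. 1.9 (6), §1.2.2, §1.5.1 (PDF pp. 5–8)] -/
theorem kimRankOneLevelTwoAt_of_thm11_of_integral
    (hK25s : Kim2025.thm11_kimShaLength_of_integralPeriod_OPEN) (hp3 : 3 ≤ p)
    (hint : ∀ {N : ℕ} [NeZero N] (D : ModularParametrizationData W N) (r : ℚ),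
      ratPlusSymbol D.f r ≠ 0 → 0 ≤ padicValRat p (ratPlusSymbol D.f r)) :
    KimRankOneLevelTwoAt W p :=
  kimRankOneLevelTwoAt_of_partial W p (kimRankOnePartialAt_of_thm11_of_integral W p hK25s hp3 hint)

/-- **P1 ⟹ the level-`k` shape in DATUM currency** modulo the integrality binder: `p ≥ 3`, surj, tower,
`L(E,1) = 0`, `r_an = 1`, `Ш` finite, datum `D` (`p ∤ c_D`, period transfer — carried), `k ≥ 1`, a
cyclic `ℓ ∈ 𝒫_k` with `kuriharaNumber D.f (p^k) ℓ ψ ≠ 0` ⟹ `ord_p #Ш(E/ℚ)(p) ≤ k − 1`.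
CONDITIONAL on the preprint. [claim: Kim2025RefinedTNC, status: under-review]
[cite: Kim2025RefinedTNC, Thm. 1.1 ("BSD") (ANNOUNCED, OPEN binder)] [cite: Kim2022StructureSelmer, Thm. 1.9 (6), §1.5.1 (PDF pp. 7–8)] -/
theorem rankOne_sha_val_le_of_thm11_of_integral_of_levelK
    (hK25s : Kim2025.thm11_kimShaLength_of_integralPeriod_OPEN) (hp3 : 3 ≤ p)
    (hint : ∀ {N : ℕ} [NeZero N] (D : ModularParametrizationData W N) (r : ℚ),
      ratPlusSymbol D.f r ≠ 0 → 0 ≤ padicValRat p (ratPlusSymbol D.f r))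
    (hsurj : W.HasSurjectiveModNGaloisRep p)
    (htower : ∀ n : ℕ, W.HasSurjectiveModNGaloisRep (p ^ n : ℕ)) (hL : W.entireLFunction 1 = 0)
    (hr : W.analyticRank = 1) (hfin : Finite W.sha)
    {N : ℕ} [NeZero N] (D : ModularParametrizationData W N) (hc : ¬ (p : ℤ) ∣ D.maninConstant)
    (hper : ∃ u : ℚ, ‖(u : ℚ_[p])‖ = 1 ∧ W.realPeriodRat = u * plusPeriod D.f)
    {k : ℕ} (hk : 1 ≤ k) (ℓ : ℕ) [Fact ℓ.Prime] (hℓ : Kato.IsKolyvaginPrime W p k ℓ)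
    (hcyc : Nat.card {P : ((WeierstrassCurve.integralModelInt W).map
        (Int.castRingHom (ZMod ℓ))).toAffine.Point // p • P = 0} ≤ p)
    (ψ : (ℓ' : ℕ) → (ZMod ℓ')ˣ →* Multiplicative (ZMod (p ^ k)))
    (hψ : Function.Surjective (ψ ℓ)) (hδ : kuriharaNumber D.f (p ^ k) ℓ ψ ≠ 0) :
    padicValNat p (Nat.card (AddCommGroup.primaryComponent W.sha p)) ≤ k - 1 :=
  rankOne_sha_val_le_of_partial_of_levelK W p
    (kimRankOnePartialAt_of_thm11_of_integral W p hK25s hp3 hint) hsurj htower hL hr hfin D hc hper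
    hk ℓ hℓ hcyc ψ hψ hδ


/-- **Datum currency, TAM rows: P1 ∧ integrality ∧ Conj. 1.10's `≥` half ⟹
`ord_p #Ш(E/ℚ)(p) + ord_p ∏_ℓ c_ℓ ≤ k − 1`** from ONE level-`k` prime certificate (p17's
`padicValNat_primaryComponent_add_le_of_partial_of_tamagawaDefectGe` fed with
`kimRankOnePartialAt_of_thm11_of_integral`). The shape the X8 / O3 / O7 TAM-DEFECT consumers use
(datum `D`, `p ∤ c_D`, period transfer). CONDITIONAL on the preprint and on Conj. 1.10.
[claim: Kim2025RefinedTNC, status: under-review] [cite: Kim2025RefinedTNC, Thm. 1.1 ("BSD") (ANNOUNCED, OPEN binder)]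
[cite: Kim2022StructureSelmer, Thm. 1.9 (6), Conj. 1.10 (PDF p. 8)] -/
theorem rankOne_sha_val_add_tamagawa_le_of_thm11_of_integral_of_levelK
    (hK25s : Kim2025.thm11_kimShaLength_of_integralPeriod_OPEN) (hp3 : 3 ≤ p)
    (hint : ∀ {N : ℕ} [NeZero N] (D : ModularParametrizationData W N) (r : ℚ),
      ratPlusSymbol D.f r ≠ 0 → 0 ≤ padicValRat p (ratPlusSymbol D.f r))
    (hsurj : W.HasSurjectiveModNGaloisRep p)
    (htower : ∀ n : ℕ, W.HasSurjectiveModNGaloisRep (p ^ n : ℕ)) (hL : W.entireLFunction 1 = 0)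
    (hr : W.analyticRank = 1) (hfin : Finite W.sha)
    {N : ℕ} [NeZero N] (D : ModularParametrizationData W N) (hc : ¬ (p : ℤ) ∣ D.maninConstant)
    (hper : ∃ u : ℚ, ‖(u : ℚ_[p])‖ = 1 ∧ W.realPeriodRat = u * plusPeriod D.f)
    (hGe : X4.KimTamagawaDefectGeAt W p D.f)
    {k : ℕ} (hk : 1 ≤ k) (ℓ : ℕ) [Fact ℓ.Prime] (hℓ : Kato.IsKolyvaginPrime W p k ℓ)
    (hcyc : Nat.card {P : ((WeierstrassCurve.integralModelInt W).map
        (Int.castRingHom (ZMod ℓ))).toAffine.Point // p • P = 0} ≤ p)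
    (ψ : (ℓ' : ℕ) → (ZMod ℓ')ˣ →* Multiplicative (ZMod (p ^ k)))
    (hψ : Function.Surjective (ψ ℓ)) (hδ : kuriharaNumber D.f (p ^ k) ℓ ψ ≠ 0) :
    padicValNat p (Nat.card (AddCommGroup.primaryComponent W.sha p)) +
      padicValNat p W.tamagawaProduct ≤ k - 1 :=
  padicValNat_primaryComponent_add_le_of_partial_of_tamagawaDefectGe W p
    (kimRankOnePartialAt_of_thm11_of_integral W p hK25s hp3 hint) hsurj htower hL hr hfin D hc hper
    hGe hk ℓ hℓ hcyc ψ hψ hδ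

/-- **Datum currency, the EXACT level closes the pair: P1 ∧ integrality ∧ Conj. 1.10's `≥` half ∧ ONE
Kurihara number non-zero modulo `p^{ord_p ∏c + 1}` at a cyclic Kolyvagin prime of that level ⟹
`#Ш(E/ℚ)(p) = 1`** (p17's `card_primaryComponent_eq_one_of_partial_of_tamagawaDefectGe` fed with
`kimRankOnePartialAt_of_thm11_of_integral`). CONDITIONAL on the preprint and on Conj. 1.10.
[claim: Kim2025RefinedTNC, status: under-review] [cite: Kim2025RefinedTNC, Thm. 1.1 ("BSD") (ANNOUNCED, OPEN binder)]
[cite: Kim2022StructureSelmer, Thm. 1.9 (6), Conj. 1.10 (PDF p. 8)] -/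
theorem rankOne_card_primaryComponent_eq_one_of_thm11_of_integral_of_exactLevel
    (hK25s : Kim2025.thm11_kimShaLength_of_integralPeriod_OPEN) (hp3 : 3 ≤ p)
    (hint : ∀ {N : ℕ} [NeZero N] (D : ModularParametrizationData W N) (r : ℚ),
      ratPlusSymbol D.f r ≠ 0 → 0 ≤ padicValRat p (ratPlusSymbol D.f r))
    (hsurj : W.HasSurjectiveModNGaloisRep p)
    (htower : ∀ n : ℕ, W.HasSurjectiveModNGaloisRep (p ^ n : ℕ)) (hL : W.entireLFunction 1 = 0)
    (hr : W.analyticRank = 1) (hfin : Finite W.sha)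
    {N : ℕ} [NeZero N] (D : ModularParametrizationData W N) (hc : ¬ (p : ℤ) ∣ D.maninConstant)
    (hper : ∃ u : ℚ, ‖(u : ℚ_[p])‖ = 1 ∧ W.realPeriodRat = u * plusPeriod D.f)
    (hGe : X4.KimTamagawaDefectGeAt W p D.f)
    (ℓ : ℕ) [Fact ℓ.Prime] (hℓ : Kato.IsKolyvaginPrime W p (padicValNat p W.tamagawaProduct + 1) ℓ)
    (hcyc : Nat.card {P : ((WeierstrassCurve.integralModelInt W).map
        (Int.castRingHom (ZMod ℓ))).toAffine.Point // p • P = 0} ≤ p)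
    (ψ : (ℓ' : ℕ) → (ZMod ℓ')ˣ →* Multiplicative (ZMod (p ^ (padicValNat p W.tamagawaProduct + 1))))
    (hψ : Function.Surjective (ψ ℓ))
    (hδ : kuriharaNumber D.f (p ^ (padicValNat p W.tamagawaProduct + 1)) ℓ ψ ≠ 0) :
    Nat.card (AddCommGroup.primaryComponent W.sha p) = 1 :=
  card_primaryComponent_eq_one_of_partial_of_tamagawaDefectGe W p
    (kimRankOnePartialAt_of_thm11_of_integral W p hK25s hp3 hint) hsurj htower hL hr hfin D hc hper
    hGe ℓ hℓ hcyc ψ hψ hδ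

/-- **At `p = 3`: P1 ⟹ `KimThreeRankOnePartial`** (p17's every-curve rank-one `∂`-conjecture at `3`)
modulo the integrality binder for every globally minimal elliptic `W` and every datum — so the O7 ∩
X4@3 TAM-row consumers of `X4RankOneKimTamagawaDefect.lean` rest on P1 ∧ integrality ∧ Conj. 1.10's
`≥` half. CONDITIONAL on the preprint. [claim: Kim2025RefinedTNC, status: under-review]
[cite: Kim2025RefinedTNC, Thm. 1.1 ("BSD") (ANNOUNCED, OPEN binder)] [cite: Sakamoto2024KolyvaginThree, Thm. 1.1] -/
theorem kimThreeRankOnePartial_of_thm11_of_integral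
    (hK25s : Kim2025.thm11_kimShaLength_of_integralPeriod_OPEN)
    (hint : ∀ (W : WeierstrassCurve ℚ) [W.IsElliptic] [W.IsGloballyMinimal] {N : ℕ} [NeZero N]
      (D : ModularParametrizationData W N) (r : ℚ),
      ratPlusSymbol D.f r ≠ 0 → 0 ≤ padicValRat 3 (ratPlusSymbol D.f r)) :
    KimThreeRankOnePartial :=
  fun W _ _ => kimRankOnePartialAt_of_thm11_of_integral W 3 hK25s le_rfl (fun D => hint W D)

/-- **At `p = 3`, additive rows: P1 ⟹ `X4SharpThreeKimRankOnePartial`** modulo the integrality binder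
on the additive-at-`3` curves (`Addv W 3`). CONDITIONAL on the preprint.
[claim: Kim2025RefinedTNC, status: under-review] [cite: Kim2025RefinedTNC, Thm. 1.1 ("BSD") (ANNOUNCED, OPEN binder)]
[cite: Sakamoto2024KolyvaginThree, Thm. 1.1] -/
theorem x4SharpThreeKimRankOnePartial_of_thm11_of_integral
    (hK25s : Kim2025.thm11_kimShaLength_of_integralPeriod_OPEN)
    (hint : ∀ (W : WeierstrassCurve ℚ) [W.IsElliptic] [W.IsGloballyMinimal], Addv W 3 →
      ∀ {N : ℕ} [NeZero N] (D : ModularParametrizationData W N) (r : ℚ),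
      ratPlusSymbol D.f r ≠ 0 → 0 ≤ padicValRat 3 (ratPlusSymbol D.f r)) :
    X4SharpThreeKimRankOnePartial :=
  fun W _ _ hadd =>
    kimRankOnePartialAt_of_thm11_of_integral W 3 hK25s le_rfl (fun D => hint W hadd D)

end Summit.BirchSwinnertonDyer.Rank1Residual.Additive

end
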